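import Literature.Topology.FourManifolds.TrisectionsTriNormalForm
import Literature.Topology.FourManifolds.CollarCriterion

/-!
# Vocabulary of the spine-transport proof of `HandlebodyExtension → SpineRigidityWithCores`
(crux `AgkCor6Sufficiency`, item stmt-SmoothPoincare4-10894, line `lp-by-sphere-system-surgery`, lead reshape r5)

Abrams–Gay–Kirby, proof of Thm. 5 ("the spine `H₀ ∪ H₁ ∪ H₂` of a trisection determines a
neighbourhood"): a based, ambiently smooth, kernel-preserving homeomorphism `ψ : F → F'` of the
central surfaces of two balanced Gay–Kirby trisections extends (by `HandlebodyExtension`) over the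
three handlebodies and then over a neighbourhood of the spine; the complements are the cores of
the sectors.  The lead's reshape r5 builds the neighbourhood diffeomorphism on OPEN sets by
*normal transport* and certifies the cores as regular sublevel sets of the tree's AMBIENT Morse
presentations (`SectorNormalForm.morse`), after normalising those presentations.  This file only
DECLARES the vocabulary shared by the registered stubs of the chain (all `Prop`-valued):

* `tubeSet Ot u v r` — the `r`-tube `{x ∈ Ot | u² + v² < r²}` of a normal frame;
* `TubeStructure` — the product structure `Ξ = (ρ, u, v) : Ot ≅ F × D_r` of a normal frame, with
  its inverse `tp` and the chart formula for `tp` in corner-slice charts;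
* `UnitSectorForm` — a sector normal form whose ambient Morse function is `1 - 2uv` near `F`
  (the tree's form `1 - 2uv·κ` with `κ ≡ 1`);
* the seam tables `refIdx`, `normIdx`, `pCo`, `qCo`, `uOfPQ`, `vOfPQ`, `unitForm`, `bandForm`:
  the seam `H_m = S (m+1) ∩ S (m+2)` (`= handlebodyOpp S m`) is the ray `{q_m = 0, p_m ≥ 0}` of
  the `(u, v)`-plane, `σ_m := G (refIdx m) - 1 = -2 p_m q_m` near `F`;
* `SpinePresentation` — the normalised ambient Morse presentation of all three sectors (input of
  the cores stub); `SeamForms` — its seam clauses (input of the transport stub);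
* `SeamFlow` — a transverse unit-speed flow for `σ_m` near a seam piece, `Ξ`-explicit in the tube;
* `ProductLikeNormalisation` — uniqueness of collars: a boundary-extending diffeomorphism can be
  made product-like near the boundary (abstract; Hirsch 8.1.9 / Bröcker–Jänich 13.7);
* `SeamDiffeos` — the three seam (handlebody) diffeomorphisms as ambient maps, `Ξ`-standard near `F`;
* `SpineTransport` — the diffeomorphism of open spine neighbourhoods, sector- and
  level-preserving.

References: Abrams–Gay–Kirby, Geom. Topol. 22 (2018), proof of Thm. 5 [AbramsGayKirby2018];
Gay–Kirby, Geom. Topol. 20 (2016), Def. 1 [GayKirby2016]; Hirsch, *Differential Topology* (1976),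
Ch. 8 §1 [HirschDT1976]; Milnor, *Morse theory* (1963), §3 [Milnor1963].
-/

noncomputable section

set_option linter.dupNamespace false

namespace Summit.SmoothPoincare4.SmoothPoincare4.Cruxes.AgkCor6Sufficiency.LpBySphereSystemSurgery

open Set Function
open scoped _root_.Manifold _root_.ContDiff _root_.Topology
open Literature.Topology.FourManifolds

/-! ## Tubes and the product structure of a normal frame -/

section Frame

variable {X : Type} [TopologicalSpace X] [ChartedSpace (EuclideanSpace ℝ (Fin 4)) X]

/-- The `r`-tube of a normal frame inside the product neighbourhood `Ot`:
`{x ∈ Ot | u x ^ 2 + v x ^ 2 < r ^ 2}`. -/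
def tubeSet (Ot : Set X) (u v : X → ℝ) (r : ℝ) : Set X :=
  {x | x ∈ Ot ∧ u x ^ 2 + v x ^ 2 < r ^ 2}

/-- **Product structure of a normal frame along the central surface** (`Ξ = (ρ, u, v)` is a
bijection of the open `Ot ⊇ F` onto `F × D_rt`, with inverse `tp`).  `S₀` is any set carrying
corner-slice charts for the frame at the points of `F` (the quadrant sector); the last clause is
the chart formula `tp p a b = Θ⁻¹ (a, b, (Θ p)₂, (Θ p)₃)` near each point of `F`, from which
consumers read the smoothness of `tp` in all three arguments (and `Ot ⊆ ⋃ sources`, by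
`tp_self`). -/
structure TubeStructure (S₀ F : Set X) (u v : X → ℝ) (ρ : X → X) (O Ot : Set X) (rt : ℝ)
    (tp : X → ℝ → ℝ → X) : Prop where
  isOpen : IsOpen Ot
  F_subset : F ⊆ Ot
  subset_O : Ot ⊆ O
  rt_pos : 0 < rt
  sq_lt : ∀ x ∈ Ot, u x ^ 2 + v x ^ 2 < rt ^ 2
  tp_mem : ∀ p ∈ F, ∀ a b : ℝ, a ^ 2 + b ^ 2 < rt ^ 2 → tp p a b ∈ Ot
  ρ_tp : ∀ p ∈ F, ∀ a b : ℝ, a ^ 2 + b ^ 2 < rt ^ 2 → ρ (tp p a b) = p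
  u_tp : ∀ p ∈ F, ∀ a b : ℝ, a ^ 2 + b ^ 2 < rt ^ 2 → u (tp p a b) = a
  v_tp : ∀ p ∈ F, ∀ a b : ℝ, a ^ 2 + b ^ 2 < rt ^ 2 → v (tp p a b) = b
  tp_self : ∀ x ∈ Ot, tp (ρ x) (u x) (v x) = x
  /-- tubes form a neighbourhood basis of `F` -/
  basis : ∀ O' : Set X, IsOpen O' → F ⊆ O' → ∃ r : ℝ, 0 < r ∧ r ≤ rt ∧ tubeSet Ot u v r ⊆ O'
  /-- the chart formula (near every point of `F`, in a corner-slice chart) -/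
  chart : ∀ p ∈ F, ∃ (C : CornerSliceChart S₀ F u v ρ) (W : Set X), IsOpen W ∧ p ∈ W ∧
    W ⊆ C.Θ.source ∧ C.Θ.source ⊆ O ∧
    ∀ p' ∈ W, p' ∈ F → ∀ a b : ℝ, a ^ 2 + b ^ 2 < rt ^ 2 →
      (!₂[a, b, C.Θ p' 2, C.Θ p' 3] : EuclideanSpace ℝ (Fin 4)) ∈ C.Θ.target ∧
      tp p' a b = C.Θ.symm (!₂[a, b, C.Θ p' 2, C.Θ p' 3])

/-- **A sector in unit normal form**: a sector normal form `SectorNormalForm S F u v ρ U O c`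
together with an EXPLICIT ambient Morse presentation `G` which is `1 - 2uv` on the open
`T ⊇ F` (the tree's `SectorNormalForm.morse` with `κ ≡ 1`, `Oκ = T`). -/
structure UnitSectorForm (S F : Set X) (u v : X → ℝ) (ρ : X → X) (U O T : Set X) (G : X → ℝ)
    (c : ℕ → ℕ) : Prop where
  toSectorNormalForm : SectorNormalForm S F u v ρ U O c
  isOpen_T : IsOpen T
  F_subset_T : F ⊆ T
  T_subset_O : T ⊆ O
  contMDiff_G : ContMDiff (𝓡 4) 𝓘(ℝ, ℝ) ∞ G
  G_eq : ∀ y ∈ T, G y = 1 - 2 * u y * v y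
  G_eq_one : ∀ p ∈ S, p ∉ interior S → G p = 1
  G_lt_one : ∀ p ∈ interior S, G p < 1
  regular_bd : ∀ p ∈ S, p ∉ interior S → p ∉ F → ¬ IsMCriticalPt (𝓡 4) G p
  nondeg : ∀ p ∈ interior S, IsMCriticalPt (𝓡 4) G p → (mhessian (𝓡 4) G p).Nondegenerate
  regular_T : ∀ p ∈ S, p ∈ T → p ∉ F → ¬ IsMCriticalPt (𝓡 4) G p
  count : ∀ n, (interior S ∩ criticalSetOfIndex (𝓡 4) G n).ncard = c n

end Frame

/-! ## Seam tables -/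

/-- The reference sector at seam `m` (`H_m = S (m+1) ∩ S (m+2)`): its Morse presentation minus
`1` is the transverse coordinate `σ_m`.  Seams `H₀ = S1 ∩ S2`, `H₁ = S2 ∩ S0`, `H₂ = S0 ∩ S1`
have reference sectors `1, 0, 0`. -/
def refIdx : Fin 3 → Fin 3 := ![1, 0, 0]

/-- The normalised sector at seam `m` (the other sector of the seam): `2, 2, 1`. -/
def normIdx : Fin 3 → Fin 3 := ![2, 2, 1]

/-- Ray coordinate `p_m` of seam `m` as a function of the normal coordinates `(u, v)`:
`p₀ = -u`, `p₁ = u`, `p₂ = v` (positive along the open ray of `H_m`). -/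
def pCo (m : Fin 3) (a b : ℝ) : ℝ := ![-a, a, b] m

/-- Transverse coordinate `q_m` of seam `m`: `q₀ = v - u`, `q₁ = v`, `q₂ = u` (zero on the ray,
nonnegative on the reference sector). -/
def qCo (m : Fin 3) (a b : ℝ) : ℝ := ![b - a, b, a] m

/-- `u` as a function of the seam coordinates `(p, q)` of seam `m`. -/
def uOfPQ (m : Fin 3) (p q : ℝ) : ℝ := ![-p, p, q] m

/-- `v` as a function of the seam coordinates `(p, q)` of seam `m`. -/
def vOfPQ (m : Fin 3) (p q : ℝ) : ℝ := ![q - p, q, p] m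

/-- The unit ambient Morse presentations of the three sectors as functions of `(u, v)`:
`1 - 2uv`, `1 - 2(v - u)(-u)`, `1 - 2(-v)(u - v)` (the wedges `{u, v ≥ 0}`, `{u ≤ 0, u ≤ v}`,
`{v ≤ 0, v ≤ u}` in their own normal coordinates). -/
def unitForm (m : Fin 3) (a b : ℝ) : ℝ :=
  ![1 - 2 * a * b, 1 - 2 * (b - a) * (-a), 1 - 2 * (-b) * (a - b)] m

/-- The radial taper of the seam modification: `0` for `p ≤ 5 r₀`, `1` for `p ≥ 6 r₀`. -/
def seamTaper (r₀ p : ℝ) : ℝ := Real.smoothTransition (p / r₀ - 5)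

/-- The band form of the normalised presentation near seam `m` in the canonical zone, as a
function of the ray coordinate `p` and of `σ = σ_m`:
`1 - σ - (σ² / (2p²)) (1 - seamTaper r₀ p)`; it is the unit form (`σ = -2pq`) for `p ≤ 5r₀` and
the seam form `1 - σ` for `p ≥ 6 r₀`. -/
def bandForm (r₀ p σ : ℝ) : ℝ := 1 - σ - σ ^ 2 / (2 * p ^ 2) * (1 - seamTaper r₀ p)

/-! ## The normalised presentation of a trisection -/

section Presentation

variable {X : Type} [TopologicalSpace X] [ChartedSpace (EuclideanSpace ℝ (Fin 4)) X]

/-- **Normalised ambient Morse presentation of the three sectors** (the part consumed by the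
cores stub): a tri-normal form for the frame `(u, v, ρ, U, O)` (wedges, corner-slice and
half-slice charts), an open `T₀` with `F ⊆ T₀ ⊆ O`, and smooth `G m` presenting `S m`
(`= 1` exactly at the non-interior points, `< 1` inside, regular at the non-interior points off
`F` and on `S m ∩ T₀ ∖ F`, nondegenerate interior critical points, `handleCount 1 k` of them),
of unit form on `T₀`. -/
structure SpinePresentation (S : Fin 3 → Set X) (u v : X → ℝ) (ρ : X → X) (U O T₀ : Set X)
    (G : Fin 3 → X → ℝ) (k : ℕ) : Prop where
  tri : TriNormalForm S 0 1 2 u v ρ U O (fun _ => handleCount 1 k)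
  isOpen_T₀ : IsOpen T₀
  F_subset_T₀ : (⋂ l, S l) ⊆ T₀
  T₀_subset_O : T₀ ⊆ O
  contMDiff_G : ∀ m, ContMDiff (𝓡 4) 𝓘(ℝ, ℝ) ∞ (G m)
  unit : ∀ m, ∀ x ∈ T₀, G m x = unitForm m (u x) (v x)
  G_eq_one : ∀ m, ∀ p ∈ S m, p ∉ interior (S m) → G m p = 1
  G_lt_one : ∀ m, ∀ p ∈ interior (S m), G m p < 1
  regular_bd : ∀ m, ∀ p ∈ S m, p ∉ interior (S m) → p ∉ (⋂ l, S l) → ¬ IsMCriticalPt (𝓡 4) (G m) p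
  regular_T₀ : ∀ m, ∀ p ∈ S m, p ∈ T₀ → p ∉ (⋂ l, S l) → ¬ IsMCriticalPt (𝓡 4) (G m) p
  nondeg : ∀ m, ∀ p ∈ interior (S m), IsMCriticalPt (𝓡 4) (G m) p →
    (mhessian (𝓡 4) (G m) p).Nondegenerate
  count : ∀ m n, (interior (S m) ∩ criticalSetOfIndex (𝓡 4) (G m) n).ncard = handleCount 1 k n

/-- **Seam clauses of the normalised presentation** at scale `r₀` for a tube structure
`(Ot, tp)` (the part consumed by the transport stub).  Write `T(r) = tubeSet Ot u v r`,
`σ_m = G (refIdx m) - 1`, `p_m = pCo m (u, v)`, `q_m = qCo m (u, v)`.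
* unit forms on `T(4 r₀)`; `T(10 r₀)` inside the tube;
* in the tube `T(10 r₀)`: `σ_m = -2 p_m q_m` on the box `{p_m > r₀ / 2, |q_m| < r₀ / 2}`, and
  `G (normIdx m) = bandForm r₀ p_m σ_m` on the thin box `{p_m > r₀, |σ_m| < ε₁}`;
* beyond: open sets `N m ⊇ H_m ∖ T(2 r₀)` on which `σ_m` is regular and, off `T(9 r₀)` and for
  `|σ_m| < ε₁`, `G (normIdx m) = 1 - σ_m`; inside `T(10 r₀)` the set `N m` is the box
  `{p_m > r₀, |q_m| < r₀ / 2}`. -/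
structure SeamForms (S : Fin 3 → Set X) (u v : X → ℝ) (Ot : Set X) (G : Fin 3 → X → ℝ)
    (r₀ ε₁ : ℝ) (N : Fin 3 → Set X) : Prop where
  r₀_pos : 0 < r₀
  ε₁_pos : 0 < ε₁
  unit : ∀ m, ∀ x ∈ tubeSet Ot u v (4 * r₀), G m x = unitForm m (u x) (v x)
  sigma_tube : ∀ m, ∀ x ∈ tubeSet Ot u v (10 * r₀), r₀ / 2 < pCo m (u x) (v x) →
    |qCo m (u x) (v x)| < r₀ / 2 → G (refIdx m) x - 1 = -2 * pCo m (u x) (v x) * qCo m (u x) (v x)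
  band : ∀ m, ∀ x ∈ tubeSet Ot u v (10 * r₀), r₀ < pCo m (u x) (v x) →
    |G (refIdx m) x - 1| < ε₁ →
    G (normIdx m) x = bandForm r₀ (pCo m (u x) (v x)) (G (refIdx m) x - 1)
  isOpen_N : ∀ m, IsOpen (N m)
  seam_subset_N : ∀ m, ∀ x ∈ S (m + 1) ∩ S (m + 2), x ∉ tubeSet Ot u v (2 * r₀) → x ∈ N m
  N_tube : ∀ m, ∀ x ∈ tubeSet Ot u v (10 * r₀),
    x ∈ N m ↔ r₀ < pCo m (u x) (v x) ∧ |qCo m (u x) (v x)| < r₀ / 2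
  regular_N : ∀ m, ∀ x ∈ N m, ¬ IsMCriticalPt (𝓡 4) (G (refIdx m)) x
  seam_form : ∀ m, ∀ x ∈ N m, x ∉ tubeSet Ot u v (9 * r₀) → |G (refIdx m) x - 1| < ε₁ →
    G (normIdx m) x = 1 - (G (refIdx m) x - 1)
  /-- in `N m` the zero set of `σ_m` is the seam -/
  zero_iff : ∀ m, ∀ x ∈ N m, G (refIdx m) x = 1 ↔ x ∈ S (m + 1) ∩ S (m + 2)
  /-- in `N m`, the reference sector is `{σ_m ≤ 0}` and the normalised one is `{σ_m ≥ 0}` -/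
  ref_iff : ∀ m, ∀ x ∈ N m, x ∈ S (refIdx m) ↔ G (refIdx m) x ≤ 1
  norm_iff : ∀ m, ∀ x ∈ N m, x ∈ S (normIdx m) ↔ 1 ≤ G (refIdx m) x
  N_disjoint : ∀ m m', m ≠ m' → Disjoint (N m) (N m')

/-- **Transverse unit-speed flow for the seam coordinate `σ_m = G (refIdx m) - 1` near the seam
piece `H_m ∖ T(2 r₀)`** (Milnor's normalised gradient flow and the drop onto a level, for the
function `σ_m` which is regular on `N m`): a flow `φ : X → ℝ → X`, defined and smooth on
`Nf ×ˢ (-δ, δ)` for an open `Nf` with `H_m ∖ T(2r₀) ⊆ Nf ⊆ N m`, moving `σ_m` at unit speed, with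
the group law, and EXPLICIT in the tube: `φ x t = tp (ρ x) (u', v')` where
`(p, q) ↦ (p, q - t / (2 p))` in the seam coordinates of `m` (so that `-2 p q` moves at unit
speed). -/
structure SeamFlow (S : Fin 3 → Set X) (u v : X → ℝ) (ρ : X → X) (Ot : Set X)
    (tp : X → ℝ → ℝ → X) (G : Fin 3 → X → ℝ) (r₀ : ℝ) (N : Fin 3 → Set X) (m : Fin 3)
    (Nf : Set X) (δ : ℝ) (φ : X → ℝ → X) : Prop where
  δ_pos : 0 < δ
  isOpen_Nf : IsOpen Nf
  Nf_subset : Nf ⊆ N m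
  seam_subset : ∀ x ∈ S (m + 1) ∩ S (m + 2), x ∉ tubeSet Ot u v (2 * r₀) → x ∈ Nf
  /-- the flow box over the seam piece stays in `Nf` -/
  box_mem : ∀ x ∈ S (m + 1) ∩ S (m + 2), x ∉ tubeSet Ot u v (2 * r₀) → ∀ t ∈ Ioo (-δ) δ, φ x t ∈ Nf
  contMDiffOn : ContMDiffOn ((𝓡 4).prod 𝓘(ℝ, ℝ)) (𝓡 4) ∞ (uncurry φ) (Nf ×ˢ Ioo (-δ) δ)
  mapsTo : ∀ x ∈ Nf, ∀ t ∈ Ioo (-δ) δ, φ x t ∈ N m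
  flow_zero : ∀ x ∈ Nf, φ x 0 = x
  flow_add : ∀ x ∈ Nf, ∀ s t : ℝ, s ∈ Ioo (-δ) δ → t ∈ Ioo (-δ) δ → s + t ∈ Ioo (-δ) δ →
    φ x s ∈ Nf → φ (φ x s) t = φ x (s + t)
  sigma_flow : ∀ x ∈ Nf, ∀ t ∈ Ioo (-δ) δ, G (refIdx m) (φ x t) - 1 = (G (refIdx m) x - 1) + t
  /-- explicit form in the tube -/
  tube_form : ∀ x ∈ Nf, x ∈ tubeSet Ot u v (10 * r₀) → ∀ t ∈ Ioo (-δ) δ,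
    φ x t = tp (ρ x)
      (uOfPQ m (pCo m (u x) (v x)) (qCo m (u x) (v x) - t / (2 * pCo m (u x) (v x))))
      (vOfPQ m (pCo m (u x) (v x)) (qCo m (u x) (v x) - t / (2 * pCo m (u x) (v x))))
  /-- the flow box stays in the tube over the tube and off the tube off a smaller tube -/
  tube_stable : ∀ x ∈ Nf, ∀ t ∈ Ioo (-δ) δ,
    (x ∈ tubeSet Ot u v (9 * r₀) → φ x t ∈ tubeSet Ot u v (10 * r₀)) ∧
    (x ∉ tubeSet Ot u v (9 * r₀) → φ x t ∉ tubeSet Ot u v (8 * r₀))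

end Presentation

/-! ## Uniqueness of collars: product-like normalisation (abstract) -/

/-- **Product-like normalisation of a boundary-extending diffeomorphism** (uniqueness of
collars; Hirsch, *Differential Topology*, Ch. 8, Thm. 1.9 and its proof; Bröcker–Jänich (13.7)):
let `H, H'` be compact smooth `3`-manifolds with boundary, `b, b'` boundary data with open collar
data `D, D'`, `φ` a diffeomorphism of the boundary carriers and `Ψ : H ≅ H'` a diffeomorphism
extending it (`Ψ ∘ b.incl = b'.incl ∘ φ`).  Then some diffeomorphism `Ψ̃ : H ≅ H'` extends `φ`
AND is product-like near the boundary: `Ψ̃ (D x t) = D' (φ x) t` for `0 ≤ t ≤ ε`. -/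
def ProductLikeNormalisation : Prop :=
  ∀ (H : Type) [TopologicalSpace H] [T2Space H] [SecondCountableTopology H] [CompactSpace H]
    [ChartedSpace (EuclideanHalfSpace 3) H] [IsManifold (𝓡∂ 3) ∞ H]
    (H' : Type) [TopologicalSpace H'] [T2Space H'] [SecondCountableTopology H'] [CompactSpace H']
    [ChartedSpace (EuclideanHalfSpace 3) H'] [IsManifold (𝓡∂ 3) ∞ H']
    (b : BoundaryData (𝓡∂ 3) H (𝓡 2)) (b' : BoundaryData (𝓡∂ 3) H' (𝓡 2))
    (D : b.OpenCollarData) (D' : b'.OpenCollarData)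
    (φ : b.carrier ≃ₘ⟮𝓡 2, 𝓡 2⟯ b'.carrier) (Ψ : H ≃ₘ⟮𝓡∂ 3, 𝓡∂ 3⟯ H'),
    ⇑Ψ ∘ b.incl = b'.incl ∘ ⇑φ →
    ∃ (Ψ' : H ≃ₘ⟮𝓡∂ 3, 𝓡∂ 3⟯ H') (ε : ℝ), 0 < ε ∧ ⇑Ψ' ∘ b.incl = b'.incl ∘ ⇑φ ∧
      ∀ (x : b.carrier) (t : ℝ), 0 ≤ t → t ≤ ε → Ψ' (D.toFun x t) = D'.toFun (φ x) t

/-! ## The seam diffeomorphisms and the transport -/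

section TwoSides

variable {X : Type} [TopologicalSpace X] [ChartedSpace (EuclideanSpace ℝ (Fin 4)) X]
  {X' : Type} [TopologicalSpace X'] [ChartedSpace (EuclideanSpace ℝ (Fin 4)) X']

/-- **The three seam diffeomorphisms, `Ξ`-standard near the central surface.**  For each
seam `m`, maps `Ψs : X → X'`, `Ψs' : X' → X`, smooth on open neighbourhoods of the seams
`H_m = S (m+1) ∩ S (m+2)`, `H'_m` (Milnor-smooth maps of the seams, ambiently extended),
mutually inverse between `H_m` and `H'_m`, and equal inside the tubes `T(rP)`, `T'(rP)` to the
product maps `tp' (Ψa (ρ ·)) (u ·) (v ·)`, `tp (Ψa' (ρ' ·)) (u' ·) (v' ·)`.  (They are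
`hd' ∘ Φ ∘ hd⁻¹` for the clause-(iii) embeddings `hd, hd'` of the handlebodies and a
diffeomorphism `Φ : H ≅ H'` given by `HandlebodyExtension`, made product-like near `∂H` by the
uniqueness of collars.) -/
def SeamDiffeos (S : Fin 3 → Set X) (S' : Fin 3 → Set X') (u v : X → ℝ) (ρ : X → X)
    (Ot : Set X) (tp : X → ℝ → ℝ → X) (u' v' : X' → ℝ) (ρ' : X' → X') (Ot' : Set X')
    (tp' : X' → ℝ → ℝ → X') (Ψa : X → X') (Ψa' : X' → X) (rP : ℝ) : Prop :=
  0 < rP ∧ ∀ m : Fin 3,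
    ∃ (W : Set X) (Ψs : X → X') (W' : Set X') (Ψs' : X' → X),
      IsOpen W ∧ S (m + 1) ∩ S (m + 2) ⊆ W ∧ ContMDiffOn (𝓡 4) (𝓡 4) ∞ Ψs W ∧
      IsOpen W' ∧ S' (m + 1) ∩ S' (m + 2) ⊆ W' ∧ ContMDiffOn (𝓡 4) (𝓡 4) ∞ Ψs' W' ∧
      MapsTo Ψs (S (m + 1) ∩ S (m + 2)) (S' (m + 1) ∩ S' (m + 2)) ∧
      MapsTo Ψs' (S' (m + 1) ∩ S' (m + 2)) (S (m + 1) ∩ S (m + 2)) ∧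
      (∀ x ∈ S (m + 1) ∩ S (m + 2), Ψs' (Ψs x) = x) ∧
      (∀ x' ∈ S' (m + 1) ∩ S' (m + 2), Ψs (Ψs' x') = x') ∧
      (∀ x ∈ S (m + 1) ∩ S (m + 2), x ∈ tubeSet Ot u v rP →
        Ψs x = tp' (Ψa (ρ x)) (u x) (v x)) ∧
      (∀ x' ∈ S' (m + 1) ∩ S' (m + 2), x' ∈ tubeSet Ot' u' v' rP →
        Ψs' x' = tp (Ψa' (ρ' x')) (u' x') (v' x'))

/-- **Transport of open spine neighbourhoods.**  Open `Ug ⊇ spine`, `Ug' ⊇ spine'` and mutually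
inverse maps `Γ`, `Γ'` between them, smooth, carrying `S m ∩ Ug` into `S' m` and intertwining
the presentations: `G' m (Γ x) = G m x` on `S m ∩ Ug` (and symmetrically). -/
def SpineTransport (S : Fin 3 → Set X) (S' : Fin 3 → Set X') (G : Fin 3 → X → ℝ)
    (G' : Fin 3 → X' → ℝ) : Prop :=
  ∃ (Ug : Set X) (Ug' : Set X') (Γ : X → X') (Γ' : X' → X),
    IsOpen Ug ∧ IsOpen Ug' ∧
    (∀ m, ∀ x ∈ S m, x ∉ interior (S m) → x ∈ Ug) ∧
    (∀ m, ∀ x ∈ S' m, x ∉ interior (S' m) → x ∈ Ug') ∧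
    ContMDiffOn (𝓡 4) (𝓡 4) ∞ Γ Ug ∧ ContMDiffOn (𝓡 4) (𝓡 4) ∞ Γ' Ug' ∧
    MapsTo Γ Ug Ug' ∧ MapsTo Γ' Ug' Ug ∧
    (∀ x ∈ Ug, Γ' (Γ x) = x) ∧ (∀ x ∈ Ug', Γ (Γ' x) = x) ∧
    (∀ m, ∀ x ∈ Ug, x ∈ S m → Γ x ∈ S' m) ∧ (∀ m, ∀ x ∈ Ug', x ∈ S' m → Γ' x ∈ S m) ∧
    (∀ m, ∀ x ∈ Ug, x ∈ S m → G' m (Γ x) = G m x)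

end TwoSides


/-! ## The seam tables: identities (a registered helper stub) -/

section Tables

/-- In seam coordinates, `u` is recovered from `(p, q)`. -/
theorem uOfPQ_pCo_qCo (m : Fin 3) (a b : ℝ) : uOfPQ m (pCo m a b) (qCo m a b) = a := by
  fin_cases m <;> simp [uOfPQ, pCo, qCo]

/-- In seam coordinates, `v` is recovered from `(p, q)`. -/
theorem vOfPQ_pCo_qCo (m : Fin 3) (a b : ℝ) : vOfPQ m (pCo m a b) (qCo m a b) = b := by
  fin_cases m <;> simp [vOfPQ, pCo, qCo]

/-- `p` is recovered from `(u, v)(p, q)`. -/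
theorem pCo_uOfPQ_vOfPQ (m : Fin 3) (p q : ℝ) : pCo m (uOfPQ m p q) (vOfPQ m p q) = p := by
  fin_cases m <;> simp [uOfPQ, vOfPQ, pCo]

/-- `q` is recovered from `(u, v)(p, q)`. -/
theorem qCo_uOfPQ_vOfPQ (m : Fin 3) (p q : ℝ) : qCo m (uOfPQ m p q) (vOfPQ m p q) = q := by
  fin_cases m <;> simp [uOfPQ, vOfPQ, qCo]

/-- **The reference presentation in seam coordinates**: `unitForm (refIdx m) - 1 = -2 p q`. -/
theorem unitForm_refIdx (m : Fin 3) (a b : ℝ) :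
    unitForm (refIdx m) a b - 1 = -2 * pCo m a b * qCo m a b := by
  fin_cases m <;> simp [unitForm, refIdx, pCo, qCo] <;> ring

/-- **The normalised presentation in seam coordinates**: `unitForm (normIdx m) = 1 + 2pq - 2q²`
(uniform in `m`). -/
theorem unitForm_normIdx (m : Fin 3) (a b : ℝ) :
    unitForm (normIdx m) a b = 1 + 2 * pCo m a b * qCo m a b - 2 * qCo m a b ^ 2 := by
  fin_cases m <;> simp [unitForm, normIdx, pCo, qCo] <;> ring

/-- `refIdx m ≠ normIdx m`. -/
theorem refIdx_ne_normIdx (m : Fin 3) : refIdx m ≠ normIdx m := by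
  fin_cases m <;> simp [refIdx, normIdx]

/-- The two sectors of seam `m` are `S (m+1)`, `S (m+2)`: `{refIdx m, normIdx m} = {m+1, m+2}`. -/
theorem refIdx_normIdx_eq (m : Fin 3) :
    (refIdx m = m + 1 ∧ normIdx m = m + 2) ∨ (refIdx m = m + 2 ∧ normIdx m = m + 1) := by
  fin_cases m <;> simp [refIdx, normIdx]

variable {X : Type}

/-- Membership in a tube. -/
theorem mem_tubeSet {Ot : Set X} {u v : X → ℝ} {r : ℝ} {x : X} :
    x ∈ tubeSet Ot u v r ↔ x ∈ Ot ∧ u x ^ 2 + v x ^ 2 < r ^ 2 := Iff.rfl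

/-- Tubes are monotone in the radius (for nonnegative radii). -/
theorem tubeSet_mono {Ot : Set X} {u v : X → ℝ} {r r' : ℝ} (hr : 0 ≤ r) (h : r ≤ r') :
    tubeSet Ot u v r ⊆ tubeSet Ot u v r' := fun x hx =>
  ⟨hx.1, lt_of_lt_of_le hx.2 (by nlinarith)⟩

/-- The band form is the seam form `1 - σ` beyond `p ≥ 6 r₀` (`r₀ > 0`). -/
theorem bandForm_of_le {r₀ p σ : ℝ} (hr₀ : 0 < r₀) (hp : 6 * r₀ ≤ p) : bandForm r₀ p σ = 1 - σ := by
  have h1 : (1 : ℝ) ≤ p / r₀ - 5 := by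
    rw [le_sub_iff_add_le, le_div_iff₀ hr₀]; linarith
  simp [bandForm, seamTaper, Real.smoothTransition.one_of_one_le h1]

/-- The band form is `1 - σ - σ²/(2p²)` (the unit form, when `σ = -2pq`) below `p ≤ 5 r₀`. -/
theorem bandForm_of_ge {r₀ p σ : ℝ} (hr₀ : 0 < r₀) (hp : p ≤ 5 * r₀) :
    bandForm r₀ p σ = 1 - σ - σ ^ 2 / (2 * p ^ 2) := by
  have h1 : p / r₀ - 5 ≤ 0 := by
    rw [sub_nonpos, div_le_iff₀ hr₀]; linarith
  simp [bandForm, seamTaper, Real.smoothTransition.zero_of_nonpos h1]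

end Tables

/-- **The seam-table toolkit** (registered helper stub of the line, proved in this file): the
coordinate identities of the seam tables and the two regimes of `bandForm`. -/
def SpineTablesToolkit : Prop :=
  (∀ (m : Fin 3) (a b : ℝ), uOfPQ m (pCo m a b) (qCo m a b) = a ∧ vOfPQ m (pCo m a b) (qCo m a b) = b) ∧
  (∀ (m : Fin 3) (p q : ℝ), pCo m (uOfPQ m p q) (vOfPQ m p q) = p ∧ qCo m (uOfPQ m p q) (vOfPQ m p q) = q) ∧
  (∀ (m : Fin 3) (a b : ℝ), unitForm (refIdx m) a b - 1 = -2 * pCo m a b * qCo m a b) ∧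
  (∀ (m : Fin 3) (a b : ℝ), unitForm (normIdx m) a b = 1 + 2 * pCo m a b * qCo m a b - 2 * qCo m a b ^ 2) ∧
  (∀ r₀ p σ : ℝ, 0 < r₀ → 6 * r₀ ≤ p → bandForm r₀ p σ = 1 - σ) ∧
  (∀ r₀ p σ : ℝ, 0 < r₀ → p ≤ 5 * r₀ → bandForm r₀ p σ = 1 - σ - σ ^ 2 / (2 * p ^ 2))

/-- **Registered helper stub `stub_spineTables`**: the seam-table toolkit. -/
theorem stub_spineTables : SpineTablesToolkit :=
  ⟨fun m a b => ⟨uOfPQ_pCo_qCo m a b, vOfPQ_pCo_qCo m a b⟩,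
    fun m p q => ⟨pCo_uOfPQ_vOfPQ m p q, qCo_uOfPQ_vOfPQ m p q⟩, unitForm_refIdx, unitForm_normIdx,
    fun _ _ _ hr hp => bandForm_of_le hr hp, fun _ _ _ hr hp => bandForm_of_ge hr hp⟩

end Summit.SmoothPoincare4.SmoothPoincare4.Cruxes.AgkCor6Sufficiency.LpBySphereSystemSurgery

end
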